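import Mathlib.Data.Nat.Choose.Basic
import Mathlib.Data.Nat.Factorial.Basic
import Mathlib.Algebra.Group.Nat.Even
import Mathlib.Algebra.BigOperators.Intervals
import Mathlib.Algebra.Order.BigOperators.Group.Finset
import Mathlib.Tactic.Ring
import Mathlib.Tactic.Linarith
import Mathlib.Tactic.IntervalCases

/-!
# `NoHeavyLowerTail` (crux stmt-CriticalPhenomena-4575), lane prim-ineq-gen-4 (gen 18): the counting condition COND(n,3) holds for
# every n ≥ 15 — so three-partition positivity for the threshold slot `Θ₃` holds in EVERY dimension ≥ 15

Support file (`--supports stmt-CriticalPhenomena-4575`; memo `run/shared/lean/prim/prim-ineq-gen-4/PROOFS-RAB-ALL-K-g18.md` §8b).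
Mathlib-only, no definitions, no `sorry`, standard axioms.

`cond_three_numeric (n) (hn : 15 ≤ n)` is exactly the numeric hypothesis of `ThreePartition.threePartN_threshold_nonneg_of_numeric` for
`k = 3` (companion file `…ThresholdRABThreePartition`); hence `0 ≤ threePartN {T | 3 ≤ T.ncard} V W` for all up-sets `V, W` on every
finite type with at least `15` points (the composition is the one-liner
`threePartN_threshold_nonneg_of_numeric 3 (cond_three_numeric _ h) V W hV hW`, file `…ThresholdRABThresholdThree`).
Proof: `n ≤ 18` by `decide`; for `n ≥ 19` bound the tiny side by `(C(n,1)+C(n,2))(C(m,0)+C(m,1)+C(m,2))` and the big side from below by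
`C(m,6)+C(m,7)` (`m = n − j ≥ 17`), and compare via the explicit polynomial identity in `poly_ineq_seventeen`.
-/

namespace Summit.CriticalPhenomena.PercolationContinuityZ3.Theorems.ThresholdRAB

open Finset

/-- `720·C(m,6) = m(m−1)(m−2)(m−3)(m−4)(m−5)`. [folklore] -/
theorem choose_six_mul (m : ℕ) : 720 * m.choose 6 = m * (m - 1) * (m - 2) * (m - 3) * (m - 4) * (m - 5) := by
  have h := Nat.descFactorial_eq_factorial_mul_choose m 6
  rw [show Nat.factorial 6 = 720 from rfl] at h
  rw [← h]
  simp [Nat.descFactorial_succ]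
  ring

/-- `5040·C(m,7) = m(m−1)(m−2)(m−3)(m−4)(m−5)(m−6)`. [folklore] -/
theorem choose_seven_mul (m : ℕ) : 5040 * m.choose 7 = m * (m - 1) * (m - 2) * (m - 3) * (m - 4) * (m - 5) * (m - 6) := by
  have h := Nat.descFactorial_eq_factorial_mul_choose m 7
  rw [show Nat.factorial 7 = 5040 from rfl] at h
  rw [← h]
  simp [Nat.descFactorial_succ]
  ring

/-- The polynomial heart: `1260 (m+2)(m+3)(m²+m+2) ≤ m(m+1)(m−1)(m−2)(m−3)(m−4)(m−5)` for `m ≥ 17`. [this work] -/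
theorem poly_ineq_seventeen (m : ℕ) (hm : 17 ≤ m) :
    1260 * ((m + 2) * (m + 3)) * (m * m + m + 2) ≤ m * (m - 1) * (m - 2) * (m - 3) * (m - 4) * (m - 5) * (m + 1) := by
  obtain ⟨t, rfl⟩ : ∃ t, m = t + 17 := ⟨m - 17, by omega⟩
  have e1 : t + 17 - 1 = t + 16 := by omega
  have e2 : t + 17 - 2 = t + 15 := by omega
  have e3 : t + 17 - 3 = t + 14 := by omega
  have e4 : t + 17 - 4 = t + 13 := by omega
  have e5 : t + 17 - 5 = t + 12 := by omega
  rw [e1, e2, e3, e4, e5]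
  have key : (t + 17) * (t + 16) * (t + 15) * (t + 14) * (t + 13) * (t + 12) * (t + 17 + 1)
      = 1260 * ((t + 17 + 2) * (t + 17 + 3)) * ((t + 17) * (t + 17) + (t + 17) + 2)
        + (t ^ 7 + 105 * t ^ 6 + 4711 * t ^ 5 + 115815 * t ^ 4 + 1647184 * t ^ 3 + 12889800 * t ^ 2
            + 44330544 * t + 12922560) := by ring
  rw [key]
  exact Nat.le_add_right _ _

/-- The binomial inequality behind COND(n,3) for large fibres: `(C(n,1)+C(n,2))·(C(m,0)+C(m,1)+C(m,2)) ≤ C(m,6)+C(m,7)` for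
`m ≥ 17`, `n ≤ m + 2`. [this work] -/
theorem choose_ineq_three (m n : ℕ) (hm : 17 ≤ m) (hn : n ≤ m + 2) :
    (n.choose 1 + n.choose 2) * (m.choose 0 + m.choose 1 + m.choose 2) ≤ m.choose 6 + m.choose 7 := by
  -- multiply by 20160 = 4 · 5040
  have hA : 2 * (n.choose 1 + n.choose 2) = n * (n + 1) := by
    rw [mul_add, Nat.choose_two_right, Nat.two_mul_div_two_of_even (Nat.even_mul_pred_self n), Nat.choose_one_right]
    cases n with
    | zero => simp
    | succ n => simp; ring
  have hB : 2 * (m.choose 0 + m.choose 1 + m.choose 2) = m * m + m + 2 := by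
    rw [mul_add, mul_add, Nat.choose_two_right, Nat.two_mul_div_two_of_even (Nat.even_mul_pred_self m), Nat.choose_zero_right,
      Nat.choose_one_right]
    have h17 : 1 ≤ m := by omega
    obtain ⟨t, rfl⟩ : ∃ t, m = t + 1 := ⟨m - 1, by omega⟩
    simp; ring
  have h6 := choose_six_mul m
  have h7 := choose_seven_mul m
  have hP := poly_ineq_seventeen m hm
  have hn2 : n * (n + 1) ≤ (m + 2) * (m + 3) := Nat.mul_le_mul hn (by omega)
  -- 20160 · LHS = 5040 · (2A)(2B) ≤ 5040 (m+2)(m+3)(m²+m+2) ≤ 4·D6·(m+1) = 20160 · RHS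
  have e6 : m - 6 + 7 = m + 1 := by omega
  have hR : 20160 * (m.choose 6 + m.choose 7)
      = 4 * (m * (m - 1) * (m - 2) * (m - 3) * (m - 4) * (m - 5) * (m + 1)) := by
    have : 20160 * (m.choose 6 + m.choose 7) = 28 * (720 * m.choose 6) + 4 * (5040 * m.choose 7) := by ring
    rw [this, h6, h7, ← e6]; ring
  have hL : 20160 * ((n.choose 1 + n.choose 2) * (m.choose 0 + m.choose 1 + m.choose 2))
      = 5040 * ((n * (n + 1)) * (m * m + m + 2)) := by
    rw [← hA, ← hB]; ring
  have : 20160 * ((n.choose 1 + n.choose 2) * (m.choose 0 + m.choose 1 + m.choose 2)) ≤ 20160 * (m.choose 6 + m.choose 7) := by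
    rw [hL, hR]
    calc 5040 * ((n * (n + 1)) * (m * m + m + 2)) ≤ 5040 * (((m + 2) * (m + 3)) * (m * m + m + 2)) := by gcongr
      _ = 4 * (1260 * ((m + 2) * (m + 3)) * (m * m + m + 2)) := by ring
      _ ≤ 4 * (m * (m - 1) * (m - 2) * (m - 3) * (m - 4) * (m - 5) * (m + 1)) := by gcongr
  exact Nat.le_of_mul_le_mul_left this (by norm_num)

/-- **COND(n,3) in numeric form holds for every `n ≥ 15`** (the shape demanded by `cond_of_numeric` / `threePartN_threshold_nonneg_of_numeric`
with `k = 3`). [this work] -/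
theorem cond_three_numeric (n : ℕ) (hn : 15 ≤ n) :
    ∀ j, 1 ≤ j → j < 3 →
      (∑ i ∈ Ico 1 3, n.choose i)
          * (∑ l ∈ range (n - j + 1), (if (j + l) + 3 ≤ 2 * 3 ∧ 3 ≤ n - (j + l) then (n - j).choose l else 0))
        ≤ ∑ l ∈ range (n - j + 1), (if 2 * 3 ≤ (j + l) + 1 ∧ 3 ≤ n - (j + l) then (n - j).choose l else 0) := by
  intro j hj1 hj3
  by_cases hsmall : n < 19
  · interval_cases n <;> interval_cases j <;> decide
  rw [not_lt] at hsmall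
  have hIco : Ico 1 3 = {1, 2} := by decide
  rw [hIco, sum_pair (by norm_num)]
  set m := n - j with hm
  have hm17 : 17 ≤ m := by omega
  have hnm : n ≤ m + 2 := by omega
  -- upper bound for the tiny sum
  have hup : ∑ l ∈ range (m + 1), (if (j + l) + 3 ≤ 2 * 3 ∧ 3 ≤ n - (j + l) then m.choose l else 0)
      ≤ m.choose 0 + m.choose 1 + m.choose 2 := by
    rw [← sum_range_add_sum_Ico _ (show 3 ≤ m + 1 by omega)]
    have hz : ∑ l ∈ Ico 3 (m + 1), (if (j + l) + 3 ≤ 2 * 3 ∧ 3 ≤ n - (j + l) then m.choose l else 0) = 0 := by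
      refine sum_eq_zero fun l hl => ?_
      rw [mem_Ico] at hl
      rw [if_neg]; omega
    rw [hz, add_zero]
    have h3 : ∑ l ∈ range 3, (if (j + l) + 3 ≤ 2 * 3 ∧ 3 ≤ n - (j + l) then m.choose l else 0)
        ≤ ∑ l ∈ range 3, m.choose l := sum_le_sum fun l _ => by split_ifs <;> simp
    refine h3.trans (le_of_eq ?_)
    simp [sum_range_succ]
  -- lower bound for the big sum
  have hlow : m.choose 6 + m.choose 7
      ≤ ∑ l ∈ range (m + 1), (if 2 * 3 ≤ (j + l) + 1 ∧ 3 ≤ n - (j + l) then m.choose l else 0) := by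
    have hsub : ({6, 7} : Finset ℕ) ⊆ range (m + 1) := by
      intro x hx; simp only [mem_insert, mem_singleton] at hx; rw [mem_range]; omega
    refine le_trans (le_of_eq ?_) (sum_le_sum_of_subset hsub)
    rw [sum_pair (by norm_num), if_pos (by omega), if_pos (by omega)]
  have hkey := choose_ineq_three m n hm17 hnm
  calc (n.choose 1 + n.choose 2) * ∑ l ∈ range (m + 1), (if (j + l) + 3 ≤ 2 * 3 ∧ 3 ≤ n - (j + l) then m.choose l else 0)
      ≤ (n.choose 1 + n.choose 2) * (m.choose 0 + m.choose 1 + m.choose 2) := Nat.mul_le_mul_left _ hup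
    _ ≤ m.choose 6 + m.choose 7 := hkey
    _ ≤ _ := hlow

end Summit.CriticalPhenomena.PercolationContinuityZ3.Theorems.ThresholdRAB
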